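import Summits.QuantumFields.YangMills.Theorems.FemtoTransferGapEigenbasis
import Mathlib.Analysis.InnerProductSpace.l2Space
import HarnessLib

/-!
# A Hilbert basis of `L²(configMeasure)` ADAPTED to the zero-flux transfer operator: the physical eigenmodes `toL2 (e k)` plus modes whose
# physical projection is annihilated by the kernel

Support module of the `FemtoTransferGap` group (fleet service by seat ym-infvol-p2; route `LuscherReduction`, crux `RunningReduction`
stmt-QuantumFields-19978 — the spectral layer of the registered stub `TT.stub_traceFormula`, whose kernel-chain ∕ averaging layer is seat ym-infvol-p1's
`…TraceFormulaDefs` ∕ `…TraceFormulaAveraging`).  `FemtoTransferGapEigenbasis.exists_isPhys_eigenseq` gives ONE `l2`-orthonormal sequence `e : ℕ → physSubmodule L`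
of physical exact eigenfunctions (`K_β e_k = λ_k e_k`, `λ_k = levelValue su2Rep L β k`, all `k`) that is complete modulo the kernel inside the physical closed
subspace.  Here it is completed to a HILBERT BASIS OF ALL OF `L²`, adapted to the trace formula:

**`exists_hilbertBasis_adapted (hβ : 0 < β)`**: there are such an `e`, a set `w ⊇ range (toL2 ∘ e)` and a Hilbert basis `b : HilbertBasis w ℝ L²` with
`⇑b = (↑)`, such that EVERY OTHER basis vector `x ∈ w ∖ range (toL2 ∘ e)` has its physical projection annihilated by the kernel: `x = y + (x − y)` with
`y ∈ physL2 L`, `x − y ⊥ physL2 L` and `∫ K_β(U,V) y(V) dV = 0` for every `U` (so `P K_β P x = 0`: in this basis the operator `P K_β P` — kernel = the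
physically averaged bond kernel — is DIAGONAL with eigenvalues `(λ_k)_k` on `range (toL2 ∘ e)` and `0` elsewhere, which is what a Hilbert-basis trace
formula `Σ_i λ_i^T = ∫ closed kernel chain` (Lit `hasSum_pow_integral_cyclic`) consumes).  Mathlib `Orthonormal.exists_hilbertBasis_extension` + the
completeness clause of `exists_isPhys_eigenseq` + self-adjointness of the orthogonal projection.

HONEST FRAMING: fixed-lattice functional analysis of the femto rung R2b1; nothing here is uniform in `L`, infinite volume, a mass gap or Clay.
References: M. Reed, B. Simon I (1980) Thm. VI.16, II.6 [cite: ReedSimonI1980]; IV (1978) XIII.1 [cite: ReedSimonIV1978]; [cite: Luscher1977].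
-/

set_option autoImplicit false

noncomputable section

open MeasureTheory Filter Topology Real
open Literature.MathematicalPhysics.QuantumFieldTheory
open Literature.MathematicalPhysics.QuantumLattice
open Literature.Analysis.OperatorTheory.YMMatrixModel
open Literature.Analysis.OperatorTheory
open scoped InnerProductSpace

namespace Summit.QuantumFields.YangMills.Theorems.FemtoTransferGap

open PhysL2

variable {L : ℕ} [NeZero L]

/-- **A Hilbert basis of `L²(configMeasure)` adapted to the zero-flux transfer operator** (`β > 0`): the classes `toL2 (e k)` of ONE physical
`l2`-orthonormal exact eigen-sequence (`K_β e_k = λ_k e_k`, `λ_k = levelValue su2Rep L β k`, every `k`; Courant–Fischer domination) extended to a Hilbert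
basis `b` of `L²` (indexed by a set `w ⊇ range (toL2 ∘ e)`, `⇑b = (↑)`) all of whose OTHER vectors `x` decompose as `x = y + (x − y)`, `y ∈ physL2 L`
(the orthogonal projection), `x − y ⊥ physL2 L`, with `∫ K_β(U,V) y(V) dV = 0` for every `U`. [cite: ReedSimonI1980, Thm. VI.16] [cite: ReedSimonIV1978, Thm. XIII.1] -/
theorem exists_hilbertBasis_adapted {β : ℝ} (hβ : 0 < β) :
    ∃ (e : ℕ → physSubmodule L) (w : Set (Lp ℝ 2 (configMeasure SU2 L))) (b : HilbertBasis w ℝ (Lp ℝ 2 (configMeasure SU2 L))),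
      (∀ i l, l2 ((e i : physSubmodule L) : GaugeConfig 3 L SU2 → ℝ) (e l) = if i = l then 1 else 0) ∧
      (∀ k, transferApply β ((e k : physSubmodule L) : GaugeConfig 3 L SU2 → ℝ) =
        levelValue su2Rep L β k • ((e k : physSubmodule L) : GaugeConfig 3 L SU2 → ℝ)) ∧
      (∀ (k : ℕ) (ψ : GaugeConfig 3 L SU2 → ℝ), IsPhys ψ →
        (∀ i, i < k → l2 ψ ((e i : physSubmodule L) : GaugeConfig 3 L SU2 → ℝ) = 0) →
          qform su2Rep β ψ ψ ≤ levelValue su2Rep L β k * l2 ψ ψ) ∧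
      Set.range (fun k => toL2 (e k)) ⊆ w ∧ (⇑b = ((↑) : w → Lp ℝ 2 (configMeasure SU2 L))) ∧
      (∀ x ∈ w, x ∉ Set.range (fun k => toL2 (e k)) →
        ∃ y : Lp ℝ 2 (configMeasure SU2 L), y ∈ physL2 L ∧ x - y ∈ (physL2 L)ᗮ ∧
          ∀ U : GaugeConfig 3 L SU2, ∫ V, transferKernel su2Rep β U V * y V ∂configMeasure SU2 L = 0) := by
  haveI : CompleteSpace (physL2 L) := isClosed_physL2.completeSpace_coe
  obtain ⟨e, hon, heig, hdom, hcomplete⟩ := exists_isPhys_eigenseq (L := L) hβ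
  -- the classes `toL2 (e k)` form an orthonormal family in `L²`, hence an orthonormal SET
  have honL2 : Orthonormal ℝ (fun k => toL2 (e k)) := by
    rw [orthonormal_iff_ite]
    intro i l
    rw [inner_toL2]
    exact hon i l
  set s : Set (Lp ℝ 2 (configMeasure SU2 L)) := Set.range (fun k => toL2 (e k)) with hs
  have hs_on : Orthonormal ℝ ((↑) : s → Lp ℝ 2 (configMeasure SU2 L)) := honL2.toSubtypeRange
  obtain ⟨w, b, hsw, hb⟩ := hs_on.exists_hilbertBasis_extension
  refine ⟨e, w, b, hon, heig, hdom, hsw, hb, fun x hxw hxs => ?_⟩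
  -- `x ⊥ toL2 (e k)` for every `k` (distinct vectors of an orthonormal basis)
  have hperp : ∀ k, ⟪toL2 (e k), x⟫_ℝ = 0 := by
    intro k
    have hk : toL2 (e k) ∈ w := hsw ⟨k, rfl⟩
    have hne : (⟨toL2 (e k), hk⟩ : w) ≠ ⟨x, hxw⟩ := by
      intro h
      apply hxs
      exact ⟨k, congrArg Subtype.val h⟩
    have h := b.orthonormal.2 hne
    rw [hb] at h
    exact h
  -- hence `P x ∈ physL2 L` is orthogonal to every `toL2 (e k)` (self-adjointness of `P`, `P (toL2 (e k)) = toL2 (e k)`)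
  set Px : Lp ℝ 2 (configMeasure SU2 L) := (physL2 L).starProjection x with hPx
  have hPxmem : Px ∈ physL2 L := Submodule.starProjection_apply_mem _ x
  have hperpP : ∀ k, ⟪toL2 (e k), Px⟫_ℝ = 0 := by
    intro k
    have hfix : (physL2 L).starProjection (toL2 (e k)) = toL2 (e k) :=
      Submodule.starProjection_eq_self_iff.mpr (toL2_mem_physL2 (e k))
    rw [hPx, ← Submodule.inner_starProjection_left_eq_right, hfix]
    exact hperp k
  -- completeness modulo the kernel
  exact ⟨Px, hPxmem, Submodule.sub_starProjection_mem_orthogonal x, fun U => hcomplete Px hPxmem hperpP U⟩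

end Summit.QuantumFields.YangMills.Theorems.FemtoTransferGap

end
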